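import Mathlib.Algebra.MvPolynomial.PDeriv
import Mathlib.LinearAlgebra.Matrix.SchurComplement
import Mathlib.RingTheory.MvPolynomial.Homogeneous
import Literature.Computability.AlgebraicComplexity.VonZurGathenRegularity
import Literature.Computability.AlgebraicComplexity.LRPencilOfMatrix
import HarnessLib

/-!
# Alper–Bogart–Velasco, Thm. 1.2: the low-order terms of `det (J + Z(x))`

Topic `Literature/Computability/AlgebraicComplexity`; first file of the proof of the named fact
`alperBogartVelasco2017_cor_1_4` (`AlperBogartVelasco.lean`: `dc(perm_3) = 7`, `dc(perm_4) ≥ 9`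
in characteristic `≠ 2`), following J. Alper, T. Bogart, M. Velasco, *A lower bound for the
determinantal complexity of a hypersurface*, Found. Comput. Math. 17 (2017) 829–836, §2.

In the proof of Thm. 1.2 (p. 4–5 of arXiv:1505.02205) the determinantal expression is brought to
the form `L(x) = J + Z(x)` with `J = diag(0, 1, …, 1)` (here: `constPart B = lamMatrix K i₀`, the
tree's `Λ_{i₀}` of `LandsbergRessayreNormalForm.lean`) and `Z` a matrix of linear forms (here: the
coefficient matrices `coeffMat B a` of `LRPencilOfMatrix.lean`), and the printed proof reads off
"since `f(x) = det_m(J + Z(x))` and the left hand side is homogeneous of degree `d > 2`, we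
conclude that the equations `Z₁₁ = 0` and `Σ_j Z_{1j} Z_{j1} = 0` hold".  This file supplies the
two coefficient identities behind that sentence, for an arbitrary square matrix `B` of affine
polynomials with constant part `Λ_{i₀}`:

* `constantCoeff_pderiv_det`: the coefficient of `x_a` in `det B` is `(A_a)_{i₀ i₀}` (= `Z₁₁`);
* `constantCoeff_pderiv_pderiv_det`: once these vanish, the coefficient of `x_a x_b` is
  `-Σ_s ((A_a)_{i₀ s} (A_b)_{s i₀} + (A_b)_{i₀ s} (A_a)_{s i₀})` (the polarisation of
  `-Σ_j Z_{1j} Z_{j1}`);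

and the two evaluation facts behind "`f ∈ I²` and all partial derivatives `∂f/∂x_i` are in `I`"
(`I` = the ideal of the first row and column of `Z`): at a point `x` where the row and the column
`i₀` of `Z(x)` vanish, `det B` and every `∂_a det B` vanish (`eval_det_eq_zero`,
`eval_pderiv_det_eq_zero`).  The tools are the row-by-row derivative of a determinant
(`VonZurGathen.derivation_det`) and the determinants of the identity matrix with one or two rows
replaced (`det_one_updateRow`, `det_one_updateRow_updateRow`, the latter via
`Matrix.det_one_add_mul_comm`).  Everything is over a commutative ring.

## References

* J. Alper, T. Bogart, M. Velasco, Found. Comput. Math. 17 (2017) 829–836,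
  doi:10.1007/s10208-015-9300-x, arXiv:1505.02205 — proof of Thm. 1.2, §2.
-/

noncomputable section

open Matrix MvPolynomial Finset

namespace Literature.Computability.AlgebraicComplexity

namespace AlperBogartVelasco

/-! ### Determinants of the identity matrix with one or two rows replaced -/

section DetOne

variable {ι : Type*} [Fintype ι] [DecidableEq ι] {R : Type*} [CommRing R]

/-- `det` of the identity matrix with the row `i` replaced by `p` is `p i`. [folklore] -/
theorem det_one_updateRow (i : ι) (p : ι → R) :
    ((1 : Matrix ι ι R).updateRow i p).det = p i := by
  rw [VonZurGathen.det_updateRow_eq_sum_mul_adjugate, adjugate_one]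
  simp [Matrix.one_apply, mul_ite]

/-- `det` of the identity matrix with the rows `i ≠ s` replaced by `p` and `q` is the `2 × 2`
minor `p i q s - p s q i` (write the matrix as `1 + U V` with `U, V` of sizes `ι × 2`, `2 × ι`
and use `det (1 + U V) = det (1 + V U)`). [folklore] -/
theorem det_one_updateRow_updateRow {i s : ι} (h : i ≠ s) (p q : ι → R) :
    (((1 : Matrix ι ι R).updateRow i p).updateRow s q).det = p i * q s - p s * q i := by
  let U : Matrix ι (Fin 2) R := Matrix.of fun r a =>
    if a = 0 then (if r = i then 1 else 0) else (if r = s then 1 else 0)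
  let V : Matrix (Fin 2) ι R := Matrix.of fun a c =>
    if a = 0 then p c - (if c = i then 1 else 0) else q c - (if c = s then 1 else 0)
  have hM : ((1 : Matrix ι ι R).updateRow i p).updateRow s q = 1 + U * V := by
    ext r c
    simp only [Matrix.add_apply, Matrix.mul_apply, Fin.sum_univ_two, U, V, Matrix.of_apply,
      updateRow_apply, Matrix.one_apply, Fin.isValue, if_true, one_ne_zero, if_false]
    by_cases hrs : r = s
    · subst hrs
      by_cases hc : c = r
      · subst hc
        simp [h.symm]
      · simp [h.symm, hc, Ne.symm hc]
    · by_cases hri : r = i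
      · subst hri
        by_cases hc : c = r
        · subst hc
          simp [hrs]
        · simp [hrs, hc, Ne.symm hc]
      · simp [hrs, hri]
  have hVU : 1 + V * U = !![p i, p s; q i, q s] := by
    ext a b
    fin_cases a <;> fin_cases b <;>
      simp [Matrix.mul_apply, U, V, h, h.symm, mul_ite, Finset.sum_ite_eq']
  rw [hM, det_one_add_mul_comm, hVU, det_fin_two_of]

omit [Fintype ι] in
/-- `Λ_{i₀}` with its row `i₀` replaced is the identity with its row `i₀` replaced. [folklore] -/
theorem lamMatrix_updateRow_self (i₀ : ι) (p : ι → R) :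
    (lamMatrix R i₀).updateRow i₀ p = (1 : Matrix ι ι R).updateRow i₀ p := by
  ext r j
  by_cases h : r = i₀
  · subst h
    rw [updateRow_self, updateRow_self]
  · rw [updateRow_ne h, updateRow_ne h, lamMatrix_apply, Matrix.one_apply]
    simp [h]

/-- Replacing a row other than `i₀` of `Λ_{i₀}` leaves the zero row `i₀`: determinant `0`.
[folklore] -/
theorem det_lamMatrix_updateRow_of_ne {i₀ r : ι} (hr : r ≠ i₀) (p : ι → R) :
    ((lamMatrix R i₀).updateRow r p).det = 0 :=
  det_eq_zero_of_row_eq_zero i₀ fun j => by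
    rw [updateRow_ne (Ne.symm hr), lamMatrix_apply]
    simp

/-- Replacing two rows other than `i₀` of `Λ_{i₀}` leaves the zero row `i₀`: determinant `0`.
[folklore] -/
theorem det_lamMatrix_updateRow_updateRow_of_ne {i₀ r s : ι} (hr : r ≠ i₀) (hs : s ≠ i₀)
    (p q : ι → R) : (((lamMatrix R i₀).updateRow r p).updateRow s q).det = 0 :=
  det_eq_zero_of_row_eq_zero i₀ fun j => by
    rw [updateRow_ne (Ne.symm hs), updateRow_ne (Ne.symm hr), lamMatrix_apply]
    simp

/-- `det` of `Λ_{i₀}` with the rows `i₀` and `s ≠ i₀` replaced by `p` and `q`. [folklore] -/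
theorem det_lamMatrix_updateRow_self_updateRow {i₀ s : ι} (hs : s ≠ i₀) (p q : ι → R) :
    (((lamMatrix R i₀).updateRow i₀ p).updateRow s q).det = p i₀ * q s - p s * q i₀ := by
  rw [lamMatrix_updateRow_self, det_one_updateRow_updateRow (Ne.symm hs)]

end DetOne

/-! ### Affine matrices with constant part `Λ_{i₀}` -/

section Affine

variable {K : Type*} [CommRing K] {σ : Type*} [Fintype σ] [DecidableEq σ]
  {ι : Type*} [Fintype ι] [DecidableEq ι]

open LRPencil

/-- The partial derivative of an affine polynomial is the constant `coeff x_a`. [folklore] -/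
theorem pderiv_eq_C_coeff {p : MvPolynomial σ K} (hp : p.totalDegree ≤ 1) (a : σ) :
    pderiv a p = C (coeff (Finsupp.single a 1) p) := by
  conv_lhs => rw [eq_affine_of_totalDegree_le_one p hp]
  simp only [map_add, pderiv_C, zero_add, map_sum, pderiv_C_mul]
  rw [Finset.sum_eq_single a]
  · simp [pderiv_X]
  · intro b _ hb
    simp [pderiv_X_of_ne hb]
  · simp

omit [Fintype σ] [DecidableEq σ] in
/-- A homogeneous polynomial of positive degree has no constant term. [folklore] -/
theorem constantCoeff_eq_zero_of_isHomogeneous {φ : MvPolynomial σ K} {d : ℕ}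
    (hφ : φ.IsHomogeneous d) (hd : d ≠ 0) : constantCoeff φ = 0 := by
  rw [constantCoeff_eq]
  exact hφ.coeff_eq_zero (by rw [map_zero]; exact fun h => hd h.symm)

variable {B : Matrix ι ι (MvPolynomial σ K)}

/-- **`∂_a det B`, row by row**: for a matrix of affine polynomials,
`∂_a det B = Σ_r det (B with row r replaced by the constants (A_a)_{r ·})`
(`VonZurGathen.derivation_det` with `∂_a B_{rj} = (A_a)_{rj}`). [folklore] -/
theorem pderiv_det_eq (hB1 : ∀ r j, (B r j).totalDegree ≤ 1) (a : σ) :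
    pderiv a B.det = ∑ r, (B.updateRow r fun j => C (coeffMat B a r j)).det := by
  rw [VonZurGathen.derivation_det]
  refine Finset.sum_congr rfl fun r _ => ?_
  have h : (fun c => pderiv a (B r c)) = fun j => C (coeffMat B a r j) :=
    funext fun j => by rw [pderiv_eq_C_coeff (hB1 r j), coeffMat_apply]
  rw [h]

/-- **`∂_b ∂_a det B`** for a matrix of affine polynomials: the double sum over `r ≠ s` of the
determinants of `B` with row `r` replaced by `(A_a)_{r ·}` and row `s` by `(A_b)_{s ·}` (the
diagonal terms vanish because the replaced row is constant). [folklore] -/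
theorem pderiv_pderiv_det_eq (hB1 : ∀ r j, (B r j).totalDegree ≤ 1) (a b : σ) :
    pderiv b (pderiv a B.det) = ∑ r, ∑ s ∈ univ.erase r,
      ((B.updateRow r fun j => C (coeffMat B a r j)).updateRow s
        fun j => C (coeffMat B b s j)).det := by
  rw [pderiv_det_eq hB1, map_sum]
  refine Finset.sum_congr rfl fun r _ => ?_
  rw [VonZurGathen.derivation_det, ← Finset.add_sum_erase _ _ (Finset.mem_univ r)]
  have h0 : ((B.updateRow r fun j => C (coeffMat B a r j)).updateRow r fun c =>
      pderiv b ((B.updateRow r fun j => C (coeffMat B a r j)) r c)).det = 0 :=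
    det_eq_zero_of_row_eq_zero r fun j => by simp
  rw [h0, zero_add]
  refine Finset.sum_congr rfl fun s hs => ?_
  have hsr : s ≠ r := (Finset.mem_erase.1 hs).1
  have hfun : (fun c => pderiv b ((B.updateRow r fun j => C (coeffMat B a r j)) s c)) =
      fun j => C (coeffMat B b s j) :=
    funext fun j => by rw [updateRow_ne hsr, pderiv_eq_C_coeff (hB1 s j), coeffMat_apply]
  rw [hfun]

variable {i₀ : ι}

/-- **The coefficient of `x_a` in `det (J + Z(x))` is `Z(x)_{i₀ i₀}`'s coefficient `(A_a)_{i₀i₀}`**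
(ABV, proof of Thm. 1.2: "we conclude that `Z₁₁ = 0`"): with constant part `Λ_{i₀}`, only the
term replacing the zero row `i₀` survives. [cite: AlperBogartVelasco2017, proof of Thm. 1.2] -/
theorem constantCoeff_pderiv_det (hB1 : ∀ r j, (B r j).totalDegree ≤ 1)
    (hB0 : constPart B = lamMatrix K i₀) (a : σ) :
    constantCoeff (pderiv a B.det) = coeffMat B a i₀ i₀ := by
  rw [pderiv_det_eq hB1, map_sum]
  have hterm : ∀ r, constantCoeff ((B.updateRow r fun j => C (coeffMat B a r j)).det) =
      ((lamMatrix K i₀).updateRow r (coeffMat B a r)).det := by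
    intro r
    rw [RingHom.map_det, RingHom.mapMatrix_apply, map_updateRow,
      show B.map ⇑constantCoeff = constPart B from rfl, hB0]
    congr 2
    funext j
    simp
  simp_rw [hterm]
  rw [Finset.sum_eq_single i₀]
  · rw [lamMatrix_updateRow_self, det_one_updateRow]
  · intro r _ hr
    exact det_lamMatrix_updateRow_of_ne hr _
  · intro h
    exact absurd (Finset.mem_univ _) h

/-- **The coefficient of `x_a x_b` in `det (J + Z(x))` once `Z₁₁ = 0`** (ABV, proof of Thm. 1.2:
"and `Σ_{j} Z_{1j} Z_{j1} = 0`", here polarised): it is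
`-Σ_s ((A_a)_{i₀ s} (A_b)_{s i₀} + (A_b)_{i₀ s} (A_a)_{s i₀})`; only the pairs of replaced rows
containing `i₀` survive, each contributing a `2 × 2` minor. [cite: AlperBogartVelasco2017, proof of Thm. 1.2] -/
theorem constantCoeff_pderiv_pderiv_det (hB1 : ∀ r j, (B r j).totalDegree ≤ 1)
    (hB0 : constPart B = lamMatrix K i₀) (h00 : ∀ a, coeffMat B a i₀ i₀ = 0) (a b : σ) :
    constantCoeff (pderiv b (pderiv a B.det)) =
      -∑ s, (coeffMat B a i₀ s * coeffMat B b s i₀ + coeffMat B b i₀ s * coeffMat B a s i₀) := by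
  rw [pderiv_pderiv_det_eq hB1, map_sum]
  simp_rw [map_sum]
  have hterm : ∀ r s, constantCoeff (((B.updateRow r fun j => C (coeffMat B a r j)).updateRow s
      fun j => C (coeffMat B b s j)).det) =
      (((lamMatrix K i₀).updateRow r (coeffMat B a r)).updateRow s (coeffMat B b s)).det := by
    intro r s
    rw [RingHom.map_det, RingHom.mapMatrix_apply, map_updateRow, map_updateRow,
      show B.map ⇑constantCoeff = constPart B from rfl, hB0]
    congr 2
    · congr 1
      funext j
      simp
    · funext j
      simp
  simp_rw [hterm]
  have hD : ∀ r s, s ≠ r →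
      (((lamMatrix K i₀).updateRow r (coeffMat B a r)).updateRow s (coeffMat B b s)).det =
        if r = i₀ then -(coeffMat B a i₀ s * coeffMat B b s i₀)
        else if s = i₀ then -(coeffMat B b i₀ r * coeffMat B a r i₀) else 0 := by
    intro r s hsr
    split_ifs with hr hs
    · subst hr
      rw [det_lamMatrix_updateRow_self_updateRow hsr, h00 a]
      ring
    · subst hs
      rw [updateRow_comm _ hr, det_lamMatrix_updateRow_self_updateRow hr, h00 b]
      ring
    · exact det_lamMatrix_updateRow_updateRow_of_ne hr hs _ _
  have hinner : ∀ r, ∑ s ∈ univ.erase r,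
      (((lamMatrix K i₀).updateRow r (coeffMat B a r)).updateRow s (coeffMat B b s)).det =
      ∑ s ∈ univ.erase r, (if r = i₀ then -(coeffMat B a i₀ s * coeffMat B b s i₀)
        else if s = i₀ then -(coeffMat B b i₀ r * coeffMat B a r i₀) else 0) :=
    fun r => Finset.sum_congr rfl fun s hs => hD r s (Finset.mem_erase.1 hs).1
  simp_rw [hinner]
  rw [← Finset.add_sum_erase _ _ (Finset.mem_univ i₀)]
  simp only [if_true]
  have hrest : ∀ r ∈ univ.erase i₀, ∑ s ∈ univ.erase r,
      (if r = i₀ then -(coeffMat B a i₀ s * coeffMat B b s i₀)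
        else if s = i₀ then -(coeffMat B b i₀ r * coeffMat B a r i₀) else 0) =
      -(coeffMat B b i₀ r * coeffMat B a r i₀) := by
    intro r hr
    have hri : r ≠ i₀ := (Finset.mem_erase.1 hr).1
    simp only [hri, if_false]
    rw [Finset.sum_ite_eq' (univ.erase r) i₀, if_pos (Finset.mem_erase.2 ⟨Ne.symm hri, mem_univ _⟩)]
  rw [Finset.sum_congr rfl hrest]
  -- compare with the full sums, whose `i₀`-terms vanish by `h00`
  have hfull1 : ∑ s, coeffMat B a i₀ s * coeffMat B b s i₀ =
      ∑ s ∈ univ.erase i₀, coeffMat B a i₀ s * coeffMat B b s i₀ := by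
    rw [← Finset.add_sum_erase _ _ (Finset.mem_univ i₀), h00 a, zero_mul, zero_add]
  have hfull2 : ∑ s, coeffMat B b i₀ s * coeffMat B a s i₀ =
      ∑ s ∈ univ.erase i₀, coeffMat B b i₀ s * coeffMat B a s i₀ := by
    rw [← Finset.add_sum_erase _ _ (Finset.mem_univ i₀), h00 b, zero_mul, zero_add]
  rw [Finset.sum_add_distrib, hfull1, hfull2, neg_add, Finset.sum_neg_distrib,
    Finset.sum_neg_distrib]

omit [DecidableEq σ] [Fintype ι] in
/-- `B(x) = Λ_{i₀} + Σ_w x_w A_w`. [folklore] -/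
theorem map_eval_eq_lamMatrix_add (hB1 : ∀ r j, (B r j).totalDegree ≤ 1)
    (hB0 : constPart B = lamMatrix K i₀) (x : σ → K) :
    B.map (MvPolynomial.eval x) = lamMatrix K i₀ + ∑ w, x w • coeffMat B w := by
  rw [map_eval_eq B hB1 x, hB0]

omit [DecidableEq σ] in
/-- **`f` vanishes on `V(I)`** (ABV, proof of Thm. 1.2: "`f ∈ I²`"): at a point `x` where the row
`i₀` of the linear part `Z(x)` vanishes, `det B(x) = 0` (the row `i₀` of `B(x)` is zero).
[cite: AlperBogartVelasco2017, proof of Thm. 1.2] -/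
theorem eval_det_eq_zero (hB1 : ∀ r j, (B r j).totalDegree ≤ 1)
    (hB0 : constPart B = lamMatrix K i₀) (x : σ → K)
    (hrow : ∀ j, (∑ w, x w • coeffMat B w) i₀ j = 0) : MvPolynomial.eval x B.det = 0 := by
  rw [RingHom.map_det, RingHom.mapMatrix_apply, map_eval_eq_lamMatrix_add hB1 hB0 x]
  exact det_eq_zero_of_row_eq_zero i₀ fun j => by
    rw [Matrix.add_apply, hrow j, lamMatrix_apply]
    simp

/-- **`∂_a f` vanishes on `V(I)`** (ABV, proof of Thm. 1.2: "all partial derivatives `∂f/∂x_i`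
are in `I`"): at a point `x` where the row and the column `i₀` of `Z(x)` vanish, and given
`Z₁₁ = 0` (`(A_a)_{i₀ i₀} = 0`), `(∂_a det B)(x) = 0`: in `Σ_r det (B(x) with row r := (A_a)_r)`
the terms `r ≠ i₀` keep the zero row `i₀`, and the term `r = i₀` has the zero column `i₀`.
[cite: AlperBogartVelasco2017, proof of Thm. 1.2] -/
theorem eval_pderiv_det_eq_zero (hB1 : ∀ r j, (B r j).totalDegree ≤ 1)
    (hB0 : constPart B = lamMatrix K i₀) (a : σ) (h00 : coeffMat B a i₀ i₀ = 0) (x : σ → K)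
    (hrow : ∀ j, (∑ w, x w • coeffMat B w) i₀ j = 0)
    (hcol : ∀ j, (∑ w, x w • coeffMat B w) j i₀ = 0) :
    MvPolynomial.eval x (pderiv a B.det) = 0 := by
  rw [pderiv_det_eq hB1, map_sum]
  refine Finset.sum_eq_zero fun r _ => ?_
  rw [RingHom.map_det, RingHom.mapMatrix_apply, map_updateRow, map_eval_eq_lamMatrix_add hB1 hB0 x]
  have hC : ⇑(MvPolynomial.eval x) ∘ (fun j => C (coeffMat B a r j)) = coeffMat B a r :=
    funext fun j => by simp
  rw [hC]
  rcases eq_or_ne r i₀ with rfl | hr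
  · refine det_eq_zero_of_column_eq_zero r fun i => ?_
    rcases eq_or_ne i r with rfl | hi
    · rw [updateRow_self]
      exact h00
    · rw [updateRow_ne hi, Matrix.add_apply, hcol i, lamMatrix_apply]
      simp [hi]
  · exact det_eq_zero_of_row_eq_zero i₀ fun j => by
      rw [updateRow_ne (Ne.symm hr), Matrix.add_apply, hrow j, lamMatrix_apply]
      simp

end Affine

end AlperBogartVelasco

end Literature.Computability.AlgebraicComplexity
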